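import Mathlib

/-!
# A2GaloisKernel — a Galois-stable subspace containing one eigenline contains its conjugates

Kernel-checked form of the logic of Step 3 of Prop. A8.1 in route/T4-A2-p6.md (sub-claim A2 of
route/TIER4.md, cell pub-hodge-repro2).  There, `W = H²(A_a × A_b, F₁)`, `T = ι(x)^*`, the
eigenlines `L_σ^{F₁}` (eigenvalues `σ(x)²`), the Galois group `Gal(F₁/ℚ)` acting semilinearly
through the coefficients, and `K = ker(λ_c ⊗ F₁)` — stable under the Galois action because
`λ_c` is defined over `ℚ`.  The argument: a semilinear bijection `ρ` (with respect to a field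
automorphism `σ`) commuting with `T` carries the `μ`-eigenspace onto the `σ μ`-eigenspace; so a
`ρ`-stable subspace containing the `μ₀`-eigenspace contains the `σ μ₀`-eigenspace; if the
conjugate eigenspaces span `W`, the subspace is everything.  (In A8.1 this gives `λ_c = 0`.)

The semilinear action is taken as data: `ρ` is a `σ`-semilinear map with a `σ'`-semilinear
inverse `ρ'` (`σ' ∘ σ = id` on scalars, `ρ ∘ ρ' = id` on vectors), `ρ'` commuting with `T`.
Nothing about Galois theory itself is needed for the logic, which is why the statement is made
for arbitrary field endomorphisms.
-/

namespace Summit.Ventures.HodgeRepro2.A2GaloisKernel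

open Module

variable {L : Type*} [Field L] {W : Type*} [AddCommGroup W] [Module L W]

/-- A `σ`-semilinear map commuting with `T` sends `μ`-eigenvectors of `T` to
`σ μ`-eigenvectors. -/
theorem mem_eigenspace_map {σ : L →+* L} (ρ : W →ₛₗ[σ] W) (T : W →ₗ[L] W)
    (hcomm : ∀ w, ρ (T w) = T (ρ w)) (μ : L) (w : W)
    (hw : w ∈ Module.End.eigenspace T μ) : ρ w ∈ Module.End.eigenspace T (σ μ) := by
  rw [Module.End.mem_eigenspace_iff] at hw
  rw [Module.End.mem_eigenspace_iff, ← hcomm, hw, LinearMap.map_smulₛₗ]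

/-- **Conjugate eigenspaces lie in a stable subspace** (Prop. A8.1, Step 3, the Galois step).
Let `ρ` be `σ`-semilinear with a `σ'`-semilinear inverse `ρ'` (`σ' (σ a) = a`, `ρ (ρ' v) = v`),
with `ρ'` commuting with `T` (then so does `ρ`).  If `K` is `ρ`-stable and contains the
`μ₀`-eigenspace of `T`, then `K` contains the `σ μ₀`-eigenspace. -/
theorem eigenspace_le_of_stable {σ σ' : L →+* L} (ρ : W →ₛₗ[σ] W) (ρ' : W →ₛₗ[σ'] W)
    (hσ : ∀ a, σ' (σ a) = a) (hρ : ∀ v, ρ (ρ' v) = v) (T : W →ₗ[L] W)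
    (hcomm' : ∀ w, ρ' (T w) = T (ρ' w))
    (K : Submodule L W) (hK : ∀ w ∈ K, ρ w ∈ K) (μ₀ : L)
    (h₀ : Module.End.eigenspace T μ₀ ≤ K) :
    Module.End.eigenspace T (σ μ₀) ≤ K := by
  intro v hv
  have h1 : ρ' v ∈ Module.End.eigenspace T (σ' (σ μ₀)) :=
    mem_eigenspace_map ρ' T hcomm' (σ μ₀) v hv
  rw [hσ] at h1
  have h2 : ρ' v ∈ K := h₀ h1
  have h3 := hK _ h2
  rwa [hρ] at h3

/-- **Transitivity ⇒ everything** (the conclusion of Step 3): for a family `(ρ i, ρ' i)` of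
commuting semilinear bijections as above whose conjugate eigenspaces `E_{σ_i μ₀}` span `W`,
a subspace stable under all `ρ i` and containing `E_{μ₀}` is the whole space. -/
theorem eq_top_of_iSup_eigenspace {ι : Type*} (σ σ' : ι → L →+* L)
    (ρ : ∀ i, W →ₛₗ[σ i] W) (ρ' : ∀ i, W →ₛₗ[σ' i] W)
    (hσ : ∀ i a, σ' i (σ i a) = a) (hρ : ∀ i v, ρ i (ρ' i v) = v) (T : W →ₗ[L] W)
    (hcomm' : ∀ i w, ρ' i (T w) = T (ρ' i w))
    (K : Submodule L W) (hK : ∀ i, ∀ w ∈ K, ρ i w ∈ K) (μ₀ : L)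
    (h₀ : Module.End.eigenspace T μ₀ ≤ K)
    (hspan : (⨆ i, Module.End.eigenspace T (σ i μ₀)) = ⊤) : K = ⊤ := by
  rw [eq_top_iff, ← hspan]
  exact iSup_le (fun i =>
    eigenspace_le_of_stable (ρ i) (ρ' i) (hσ i) (hρ i) T (hcomm' i) K (hK i) μ₀ h₀)

/-- The form used in A8.1: a linear functional `lam : W →ₗ[L] L` whose kernel is stable under
the family and contains `E_{μ₀}` vanishes identically (there: `λ_c ⊗ F₁ = 0`, hence `λ_c = 0`). -/
theorem eq_zero_of_ker_stable {ι : Type*} (σ σ' : ι → L →+* L)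
    (ρ : ∀ i, W →ₛₗ[σ i] W) (ρ' : ∀ i, W →ₛₗ[σ' i] W)
    (hσ : ∀ i a, σ' i (σ i a) = a) (hρ : ∀ i v, ρ i (ρ' i v) = v) (T : W →ₗ[L] W)
    (hcomm' : ∀ i w, ρ' i (T w) = T (ρ' i w))
    (lam : W →ₗ[L] L)
    (hker : ∀ i, ∀ w ∈ LinearMap.ker lam, ρ i w ∈ LinearMap.ker lam) (μ₀ : L)
    (h₀ : Module.End.eigenspace T μ₀ ≤ LinearMap.ker lam)
    (hspan : (⨆ i, Module.End.eigenspace T (σ i μ₀)) = ⊤) : lam = 0 := by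
  have h := eq_top_of_iSup_eigenspace σ σ' ρ ρ' hσ hρ T hcomm' (LinearMap.ker lam) hker
    μ₀ h₀ hspan
  exact LinearMap.ker_eq_top.mp h

/-- The stability hypothesis in A8.1 comes for free: a functional `lam` which is
`σ`-equivariant (`lam (ρ w) = σ (lam w)` — the case of a functional defined over the fixed
field, extended to `W`) has a `ρ`-stable kernel. -/
theorem ker_stable_of_equivariant {σ : L →+* L} (ρ : W →ₛₗ[σ] W) (lam : W →ₗ[L] L)
    (hequiv : ∀ w, lam (ρ w) = σ (lam w)) (w : W) (hw : w ∈ LinearMap.ker lam) :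
    ρ w ∈ LinearMap.ker lam := by
  rw [LinearMap.mem_ker] at hw ⊢
  rw [hequiv, hw, map_zero]

end Summit.Ventures.HodgeRepro2.A2GaloisKernel
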